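import Literature.AnabelianGeometry.EtaleTheta.TemperedFrobenioidToyLinearRigidity

/-!
# [EtTh] Cor. 3.8, proof rows `PreservesPreSteps` (C38-L02a) and `PreservesPrimarySteps` (C38-L02b):
# RIGIDITY at the toy tempered Frobenioid — EVERY self-equivalence preserves (primary) (pre-)steps

S. Mochizuki, *The étale theta function and its Frobenioid-theoretic manifestations*, Publ. RIMS **45**
(2009) [MochizukiEtTh2009], proof of Cor. 3.8, PDF p. 81 l. 2–3: "by [Mzk17], Theorem 3.4, (ii); [Mzk17],
Theorem 4.2, (i), it follows that `Ψ` preserves pre-steps and primary steps" [cite: MochizukiEtTh2009, Cor 3.8 p.81];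
S. Mochizuki, *The geometry of Frobenioids I*, Kyushu J. Math. **62** (2008), Def. 1.2 (iii) p. 22 (pre-steps, steps,
primary steps), Thm. 3.4 (ii) p. 62, Thm. 4.2 (i) p. 85 [cite: MochizukiFrdI2008, Def. 1.2 (iii) p.22].

abc-iut cell, block F (FACT-LIST fact-proving wave), seat abc-iut-f-136 (gen 3), FLOAT rows **F-2809**
`Cor38Hyp.PreservesPreSteps` and **F-2810** `Cor38Hyp.PreservesPrimarySteps` (abc-iut-w5-d124's sub-DAG file
`TemperedFrobenioidCor38Sub.lean`; class `preparatory`, kernel_closedness `parametrised` — the parameter is an ARBITRARY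
equivalence `Ψ`).  Instance forms of record: abc-iut-f-001 `preservesPreSteps_treeCatVocab` /
`preservesPrimarySteps_treeCatVocab` (p430635, modulo the named facts [FrdI] Thm. 3.4 (ii) / Thm. 4.2 (i)).  Sequel of
`TemperedFrobenioidToyLinearRigidity.lean` (p447439: EVERY self-equivalence of the toy category preserves `deg_Fr = 1`,
by an intrinsic characterisation of linearity).  THIS file (proof-only) derives the INSTANCE-FAMILY forms of the two rows
at abc-iut-L2-t3's toy tempered Frobenioid `Toy.temperedFrobenioid` (one-object base, `Φ = ℕ`, `B = ℤ`):
* every morphism of the toy category is a base-isomorphism (one-object DISCRETE base), so pre-step = linear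
  (`Toy.opsData_isPreStep_iff`) and **`Toy.preservesPreSteps_of_cor38Hyp`**: F-2809 holds for EVERY
  `h : Cor38Hyp Toy.temperedFrobenioid Toy.temperedFrobenioid`;
* the isomorphisms of the toy category are exactly the linear morphisms with zero divisor `0`
  (`Toy.isIso_iff_degFr_eq_one_and_div_eq_one`), every non-zero element of `Φ(A) = ℕ` is primary
  (`Toy.isPrimary_iff_ne_one`), hence primary pre-step = step = linear non-isomorphism
  (`Toy.opsData_isPrimaryPreStep_iff`, `Toy.opsData_isStep_iff`); fully faithful functors reflect isomorphisms, so
  **`Toy.preservesPrimarySteps_of_cor38Hyp`**: F-2810 holds for EVERY such record.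
Reading (cell rule R5): instance-FAMILY forms (all `Ψ` at one record pair), supporting the conjecture that the bare
closures are true (anchor/orientation obstruction, HOME/staging/f/f-136/g3/F-2815-CLOSURE-CENSUS-f136g3.md); the bare
closures themselves stay undecided.  HONEST FRAMING: a statement about OUR typed toy record; refereed pre-IUT material;
nothing here bears on the disputed [IUTchIII] Cor. 3.12; no side taken; typed ≠ proved.
-/

noncomputable section

namespace Literature.AnabelianGeometry.EtaleTheta

open CategoryTheory Opposite Literature.AlgebraicGeometry.Frobenioids

namespace Toy

/-! ### §1  Base-isomorphisms and pre-steps in the toy category -/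

/-- The vocabulary predicates of the toy's [FrdI] operations, unfolded: base-isomorphism.
[cite: MochizukiFrdI2008, Def. 1.2 (ii) p.21] -/
theorem opsData_isBaseIso_iff {X Y : temperedFrobenioid.category} (φ : X ⟶ Y) :
    temperedFrobenioid.opsData.IsBaseIso φ ↔ IsIso (ModelFrobenioid.baseMap φ) := Iff.rfl

/-- **Every morphism of the toy category is a base-isomorphism**: the base is the one-object DISCRETE category.
[cite: MochizukiFrdI2008, Def. 1.2 (ii) p.21] -/
theorem opsData_isBaseIso {X Y : temperedFrobenioid.category} (φ : X ⟶ Y) :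
    temperedFrobenioid.opsData.IsBaseIso φ := by
  rw [opsData_isBaseIso_iff]
  obtain ⟨⟨⟨⟩⟩, α⟩ := X
  obtain ⟨⟨⟨⟩⟩, β⟩ := Y
  rw [Subsingleton.elim (ModelFrobenioid.baseMap φ) (𝟙 _)]
  infer_instance

/-- **Pre-step = linear in the toy category.** [cite: MochizukiFrdI2008, Def. 1.2 (iii) p.22] -/
theorem opsData_isPreStep_iff {X Y : temperedFrobenioid.category} (φ : X ⟶ Y) :
    temperedFrobenioid.opsData.IsPreStep φ ↔ ModelFrobenioid.degFr φ = 1 :=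
  ⟨fun h => h.1, fun h => ⟨h, opsData_isBaseIso φ⟩⟩

/-- **Row F-2809 holds at EVERY `Cor38Hyp` record on the toy tempered Frobenioid**: every self-equivalence `Ψ` of
`Toy.temperedFrobenioid.category` carries pre-steps to pre-steps, in both directions.
[cite: MochizukiEtTh2009, Cor 3.8 p.81] -/
theorem preservesPreSteps_of_cor38Hyp (h : Cor38Hyp temperedFrobenioid temperedFrobenioid) : h.PreservesPreSteps :=
  ⟨fun _ _ φ hφ => (opsData_isPreStep_iff _).2
      (degFr_map_eq_one_of_full_faithful h.Ψ.functor φ ((opsData_isPreStep_iff φ).1 hφ)),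
    fun _ _ φ hφ => (opsData_isPreStep_iff _).2
      (degFr_map_eq_one_of_full_faithful h.Ψ.inverse φ ((opsData_isPreStep_iff φ).1 hφ))⟩

/-! ### §2  Isomorphisms of the toy category: linear with zero divisor `0` -/

/-- An isomorphism of the toy category is linear. [cite: MochizukiFrdI2008, Thm. 5.2(i) p.100] -/
theorem degFr_eq_one_of_isIso {X Y : temperedFrobenioid.category} (φ : X ⟶ Y) [IsIso φ] :
    ModelFrobenioid.degFr φ = 1 := by
  have h := congrArg (fun χ : X ⟶ X => (ModelFrobenioid.degFr χ : ℕ)) (IsIso.hom_inv_id φ)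
  simp only [ModelFrobenioid.degFr_comp, PNat.mul_coe, ModelFrobenioid.degFr_id, PNat.one_coe] at h
  exact PNat.coe_inj.mp ((Nat.eq_one_of_mul_eq_one_left h).trans PNat.one_coe.symm)

/-- An isomorphism of the toy category has zero divisor `0`. [cite: MochizukiFrdI2008, Thm. 5.2(i) p.100] -/
theorem div_eq_one_of_isIso {X Y : temperedFrobenioid.category} (φ : X ⟶ Y) [IsIso φ] :
    ModelFrobenioid.div φ = 1 := by
  have h := congrArg (fun χ : X ⟶ X => Multiplicative.toAdd (α := ℕ) (ModelFrobenioid.div χ).1) (IsIso.hom_inv_id φ)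
  rw [ModelFrobenioid.div_comp, toAdd_val_mul, toAdd_val_pow, coe_divisorMonoid_map, ModelFrobenioid.div_id] at h
  change _ = (0 : ℕ) at h
  have h0 : (ModelFrobenioid.degFr (inv φ) : ℕ) * Multiplicative.toAdd (α := ℕ) (ModelFrobenioid.div φ).1 = 0 := by
    omega
  have hb : Multiplicative.toAdd (α := ℕ) (ModelFrobenioid.div φ).1 = 0 :=
    (Nat.mul_eq_zero.mp h0).resolve_left (ModelFrobenioid.degFr (inv φ)).ne_zero
  exact Subtype.ext (Multiplicative.toAdd.injective hb)

/-- **A linear morphism of the toy category with zero divisor `0` is an isomorphism** (its inverse is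
`(1, id, 0, u⁻¹)`). [cite: MochizukiFrdI2008, Thm. 5.2(i) p.100] -/
theorem isIso_of_degFr_eq_one_of_div_eq_one {X Y : temperedFrobenioid.category} (φ : X ⟶ Y)
    (hd : ModelFrobenioid.degFr φ = 1) (hz : ModelFrobenioid.div φ = 1) : IsIso φ := by
  obtain ⟨⟨⟨⟩⟩, α⟩ := X
  obtain ⟨⟨⟨⟩⟩, β⟩ := Y
  have hmem : (Multiplicative.ofAdd (-(Multiplicative.toAdd (α := ℤ) (ModelFrobenioid.unit φ).1.1)),
      ((ModelFrobenioid.unit φ).1.2)⁻¹) ∈ temperedFrobenioid.ratFn (op ⟨⟨⟩⟩) := by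
    have h2 : divHom (ModelFrobenioid.unit φ).1.1 = temperedFrobenioid.ΦgpToRlog _ (ModelFrobenioid.unit φ).1.2 :=
      (ModelFrobenioid.unit φ).2
    change divHom (Multiplicative.ofAdd (-(Multiplicative.toAdd (α := ℤ) (ModelFrobenioid.unit φ).1.1))) =
      temperedFrobenioid.ΦgpToRlog _ ((ModelFrobenioid.unit φ).1.2)⁻¹
    rw [ofAdd_neg, ofAdd_toAdd, map_inv, map_inv, h2]
    rfl
  have hinv : divB temperedFrobenioid.divisorMonoid temperedFrobenioid.ratFnFunctor temperedFrobenioid.divBNatTrans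
      (op ⟨⟨⟩⟩) ⟨_, hmem⟩ =
      (divB temperedFrobenioid.divisorMonoid temperedFrobenioid.ratFnFunctor temperedFrobenioid.divBNatTrans
        (op ⟨⟨⟩⟩) (ModelFrobenioid.unit φ))⁻¹ := rfl
  have hrel := ModelFrobenioid.rel φ
  rw [hd, hz, PNat.one_coe, pow_one, map_one, mul_one, Subsingleton.elim (ModelFrobenioid.baseMap φ) (𝟙 _),
    pullGp_id] at hrel
  obtain ⟨ψ, hψd, hψz⟩ : ∃ ψ : (⟨⟨⟨⟩⟩, β⟩ : temperedFrobenioid.category) ⟶ ⟨⟨⟨⟩⟩, α⟩,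
      ModelFrobenioid.degFr ψ = 1 ∧ ModelFrobenioid.div ψ = 1 :=
    ⟨{ degFr := 1, base := 𝟙 _, div := 1, unit := ⟨_, hmem⟩,
       rel := by
        rw [PNat.one_coe, pow_one, map_one, mul_one, pullGp_id, hinv, hrel, mul_inv_cancel_right] }, rfl, rfl⟩
  refine ⟨ψ, hom_eq_of_degFr_eq_of_div_eq ?_ ?_, hom_eq_of_degFr_eq_of_div_eq ?_ ?_⟩
  · rw [ModelFrobenioid.degFr_comp, hd, hψd, ModelFrobenioid.degFr_id, mul_one]
  · rw [ModelFrobenioid.div_comp, hz, hψz, map_one, one_pow, mul_one, ModelFrobenioid.div_id]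
  · rw [ModelFrobenioid.degFr_comp, hd, hψd, ModelFrobenioid.degFr_id, mul_one]
  · rw [ModelFrobenioid.div_comp, hz, hψz, map_one, one_pow, mul_one, ModelFrobenioid.div_id]

/-- **The isomorphisms of the toy category are exactly the linear morphisms with zero divisor `0`.**
[cite: MochizukiFrdI2008, Thm. 5.2(i) p.100] -/
theorem isIso_iff_degFr_eq_one_and_div_eq_one {X Y : temperedFrobenioid.category} (φ : X ⟶ Y) :
    IsIso φ ↔ ModelFrobenioid.degFr φ = 1 ∧ ModelFrobenioid.div φ = 1 :=
  ⟨fun _ => ⟨degFr_eq_one_of_isIso φ, div_eq_one_of_isIso φ⟩,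
    fun h => isIso_of_degFr_eq_one_of_div_eq_one φ h.1 h.2⟩

/-! ### §3  Primary elements of `Φ(A) = ℕ`; primary pre-steps and steps in the toy category -/

/-- **In the one-prime monoid `Φ(A) = ℕ` of the toy every non-zero element is primary** ([FrdI] §0: `a ≠ 0` and
`0 ≠ b ≼ a ⇒ a ≼ b`; here `a ∣ n·b` for `n = a`). [cite: MochizukiFrdI2008, §0 p.12] -/
theorem isPrimary_iff_ne_one {A : (Discrete PUnit.{1})ᵒᵖ} (z : temperedFrobenioid.divisorMonoid.obj A) :
    IsPrimary z ↔ z ≠ 1 := by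
  refine ⟨fun h => h.1, fun hz => ⟨hz, fun b hb _ => ?_⟩⟩
  have hzn : Multiplicative.toAdd (α := ℕ) z.1 ≠ 0 := fun h =>
    hz (Subtype.ext (Multiplicative.toAdd.injective h))
  have hbn : Multiplicative.toAdd (α := ℕ) b.1 ≠ 0 := fun h =>
    hb (Subtype.ext (Multiplicative.toAdd.injective h))
  refine ⟨Multiplicative.toAdd (α := ℕ) z.1, Nat.pos_of_ne_zero hzn,
    ⟨⟨Multiplicative.ofAdd (α := ℕ) (Multiplicative.toAdd (α := ℕ) z.1 * Multiplicative.toAdd (α := ℕ) b.1 -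
        Multiplicative.toAdd (α := ℕ) z.1), trivial⟩, Subtype.ext (Multiplicative.toAdd.injective ?_)⟩⟩
  change Multiplicative.toAdd (α := ℕ) (b ^ Multiplicative.toAdd (α := ℕ) z.1).1 =
    Multiplicative.toAdd (α := ℕ) (z * _).1
  rw [toAdd_val_pow, toAdd_val_mul]
  change _ = _ + Multiplicative.toAdd (α := ℕ) (Multiplicative.ofAdd (α := ℕ) _)
  rw [toAdd_ofAdd]
  have hle : Multiplicative.toAdd (α := ℕ) z.1 ≤
      Multiplicative.toAdd (α := ℕ) z.1 * Multiplicative.toAdd (α := ℕ) b.1 :=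
    Nat.le_mul_of_pos_right _ (Nat.pos_of_ne_zero hbn)
  generalize Multiplicative.toAdd (α := ℕ) z.1 * Multiplicative.toAdd (α := ℕ) b.1 = P at hle ⊢
  omega

/-- The vocabulary predicates unfolded: primary pre-step. [cite: MochizukiFrdI2008, Def. 1.2 (iii) p.22] -/
theorem opsData_isPrimaryPreStep_def {X Y : temperedFrobenioid.category} (φ : X ⟶ Y) :
    temperedFrobenioid.opsData.IsPrimaryPreStep φ ↔
      temperedFrobenioid.opsData.IsPreStep φ ∧ IsPrimary (ModelFrobenioid.div φ) := Iff.rfl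

/-- The vocabulary predicates unfolded: step. [cite: MochizukiFrdI2008, Def. 1.2 (iii) p.22] -/
theorem opsData_isStep_def {X Y : temperedFrobenioid.category} (φ : X ⟶ Y) :
    temperedFrobenioid.opsData.IsStep φ ↔ temperedFrobenioid.opsData.IsPreStep φ ∧ ¬ IsIso φ := Iff.rfl

/-- **Primary pre-step = linear non-isomorphism in the toy category.** [cite: MochizukiFrdI2008, Def. 1.2 (iii) p.22] -/
theorem opsData_isPrimaryPreStep_iff {X Y : temperedFrobenioid.category} (φ : X ⟶ Y) :
    temperedFrobenioid.opsData.IsPrimaryPreStep φ ↔ ModelFrobenioid.degFr φ = 1 ∧ ¬ IsIso φ := by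
  rw [opsData_isPrimaryPreStep_def, opsData_isPreStep_iff, isPrimary_iff_ne_one]
  refine ⟨fun h => ⟨h.1, fun _ => h.2 (div_eq_one_of_isIso φ)⟩,
    fun h => ⟨h.1, fun hz => h.2 (isIso_of_degFr_eq_one_of_div_eq_one φ h.1 hz)⟩⟩

/-- **Step = linear non-isomorphism in the toy category.** [cite: MochizukiFrdI2008, Def. 1.2 (iii) p.22] -/
theorem opsData_isStep_iff {X Y : temperedFrobenioid.category} (φ : X ⟶ Y) :
    temperedFrobenioid.opsData.IsStep φ ↔ ModelFrobenioid.degFr φ = 1 ∧ ¬ IsIso φ := by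
  rw [opsData_isStep_def, opsData_isPreStep_iff]

/-- Fully faithful endofunctors of the toy category preserve "linear non-isomorphism" (they preserve linearity,
p447439, and reflect isomorphisms). [cite: MochizukiEtTh2009, Cor 3.8 p.81] -/
theorem degFr_eq_one_and_not_isIso_map_of_full_faithful
    (F : temperedFrobenioid.category ⥤ temperedFrobenioid.category) [F.Full] [F.Faithful]
    {X Y : temperedFrobenioid.category} (φ : X ⟶ Y) (h : ModelFrobenioid.degFr φ = 1 ∧ ¬ IsIso φ) :
    ModelFrobenioid.degFr (F.map φ) = 1 ∧ ¬ IsIso (F.map φ) :=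
  ⟨degFr_map_eq_one_of_full_faithful F φ h.1, fun _ => h.2 (isIso_of_fully_faithful F φ)⟩

/-- **Row F-2810 holds at EVERY `Cor38Hyp` record on the toy tempered Frobenioid**: every self-equivalence `Ψ` of
`Toy.temperedFrobenioid.category` carries primary steps to primary steps, in both directions.
[cite: MochizukiEtTh2009, Cor 3.8 p.81] -/
theorem preservesPrimarySteps_of_cor38Hyp (h : Cor38Hyp temperedFrobenioid temperedFrobenioid) :
    h.PreservesPrimarySteps := by
  refine ⟨fun X Y φ hφ => ?_, fun X Y φ hφ => ?_⟩
  · have h' := degFr_eq_one_and_not_isIso_map_of_full_faithful h.Ψ.functor φ ((opsData_isStep_iff φ).1 hφ.1)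
    exact ⟨(opsData_isStep_iff _).2 h', (opsData_isPrimaryPreStep_iff _).2 h'⟩
  · have h' := degFr_eq_one_and_not_isIso_map_of_full_faithful h.Ψ.inverse φ ((opsData_isStep_iff φ).1 hφ.1)
    exact ⟨(opsData_isStep_iff _).2 h', (opsData_isPrimaryPreStep_iff _).2 h'⟩

/-- The universally quantified forms over the toy: rows F-2809 and F-2810 for ALL `Cor38Hyp` records between the toy
and itself (records exist: `Toy.nonempty_cor38Hyp`). [cite: MochizukiEtTh2009, Cor 3.8 p.81] -/
theorem forall_cor38Hyp_preservesPreSteps_and_preservesPrimarySteps :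
    ∀ h : Cor38Hyp temperedFrobenioid temperedFrobenioid, h.PreservesPreSteps ∧ h.PreservesPrimarySteps :=
  fun h => ⟨preservesPreSteps_of_cor38Hyp h, preservesPrimarySteps_of_cor38Hyp h⟩

end Toy

end Literature.AnabelianGeometry.EtaleTheta
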